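import Summits.QuantumFields.YangMills.Theorems.BalabanUVNodesK0S5CollarCubeDomains
import HarnessLib

/-!
# K0⁷ `stub_prop8StepCoP13` (stmt-QuantumFields-20541), sub-target S5 — **THE CORE COLLAR AND THE NEAR CLASS FOR ANY FAMILY BELOW THE COLLARED CUBE TOWER** (print's (150) family
# `Ω′_j = □_j ∩ Ω_j` at a boundary datum = dag-n07-e's meet `cubeDomains ⊓ D_rec`, INTENT-44): [Balaban1985Variational] p. 301 (147)–(150) keeps `□′_k^{(k−1)} = □_k ∖ Ω_k` in `Λ′_{k−1}`, so the
# NEAR cells of (161) are the level-`k` cells AND the level-(k−1) cells whose block lies in the top cube `□_k^{(k)}`, and every OTHER cell is `ρ`-far from the box — P13's collar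
# argument (`K0S5CollarCubeDomains`) needs of a cell only «its source block is NOT in `□_{j+1}^{(j+1)}`», not that the family IS `cubeDomains`; this file re-types it for an ARBITRARY
# `D′ : Domains P` of height `k`, giving FILE 3's near-class socket (`K0S5NearClassSocket.hbRows164_core_of_adm22_T4_nearClassW`) its `hcollar` binder at the meet family with the near
# predicate `near c :↔ j(c) = k ∨ B(c₋) ∈ □_{j(c)+1}^{(j(c)+1)}`, and — when `D′` contains the cube tower strictly below the top (`□̃ ⊆ Ω_{k−1}`, the HEAD's collar) — the identification
# «a near cell below the top is at level `k − 1`» (print's `□′_k^{(k−1)}`; the (160) bound there carries the weight `L¹`)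

Cell `pub-ymgap`, width seat `pub-ymgap-k0-s1-w3` gen 5 (HUMAN RULING D-0149; START LIST v11 §k0-s1; bus QUESTION «Q-CUBE-TOP» I.30591, dag-n07-e g20 ANSWER (Q1) + INTENT-44
`Node00/DomainsMeet` I.≈30725, CLAIM-4 of g5).  `--kind proof --supports stmt-QuantumFields-20541 --as helper`; count-neutral; def-free; nothing restated (P13
`succ_le_distSite_of_not_deep` ∕ `pow_le_gs`, ym3-torus `FlatPortChart.mul_distSite_blockOf_le` BY NAME; P13's `le_distBI_cubeDomains_of_mem_box` is the instance `D′ := cubeDomains …`).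

THE PRINT (p. 301): *«V′ is defined on (□_k ∩ Λ_{k−1}) ∪ (□_k ∩ Λ_k) = □′_k^{(k−1)} ∪ □″_k^{(k)} … (147) … Λ′_{k−1} = (□_{k−1}^{(k−1)} ∖ □_k^{(k−1)}) ∪ □′_k^{(k−1)}, Λ′_k = □″_k^{(k)} (148) …
U′_k ∈ 𝔄_k({Ω′_j}, ε₀) ∩ 𝔅_k(ℭ_k, V″) ∩ Ax_k(ℭ_k, 1), where Ω′_j = □_j, j = 0, 1, …, k − 1, Ω′_k = □″_k (150) … a minimum of this functional in the space (150), because this space is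
defined by more restrictive functional conditions»*; p. 303 (160) *«for ⟨x, x′⟩ ∈ □′_k^{(k−1)} ∪ □″_k^{(k)}»*; p. 300 (144) *«dist(□_{n+1}, □_nᶜ) = R₁M₁Lⁿη»*.  dag-n07-e g20 (declarer of
`cubeDomains`, ANSWER (Q1)): *«`cubeDomains P a M ρ i` … is print's family ONLY for interior datums; at a boundary datum the per-cube family of (150) is the LEVELWISE MEET with the
record's family: `Ω′_j := □_j ∩ Ω_j` … `ker Q_{D′} ⊆ ker Q_{D_rec}`»* — the meet agrees with `cubeDomains` strictly below the top as soon as `□̃ ⊆ Ω_{k−1}` (the HEAD's collar, p592904).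

WHAT IS PROVED (sorry-free; axioms standard; no definition; every `Params`; `D′ : Domains P` arbitrary with `D′.k = k`).
§1 ★★ `le_distBI_of_not_cubeDeep` — for `b₋ = π x`, `x ∈ □ = box L a M k`, and every index bond `c` of `D′` at a level `j(c) < k` whose source block is NOT in `□_{j(c)+1}^{(j(c)+1)}` of the
   cube tower `cubeDomains P a M ρ k hk`: `ρ ≤ distBI D′ b c` (P13's proof, the one use of the family replaced by the hypothesis); ★★ `hcollar_of_not_near` — the WINDOW form in FILE 3's binder
   shape: `∀ b, b₋ ∈ π '' □ → ∀ c : BondIdx D′, ¬ (j(c) = k ∨ B(c₋) ∈ □_{j(c)+1}^{(j(c)+1)}) → ρ ≤ distBI D′ b c`.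
§2 ★ `level_succ_eq_of_near_below` — if `D′` CONTAINS the cube tower at the levels `1 ≤ i < k` (`(cubeDomains …).Om i ⊆ D′.Om i`; the meet does, given `□̃ ⊆ Ω_{k−1}`), a cell of `D′` below
   the top whose source block lies in `□_{j(c)+1}^{(j(c)+1)}` is at level `j(c) = k − 1` (it would otherwise be `D′`-deep) — print's `□′_k^{(k−1)}`; ★ `near_cases` (every cell: level `k`, or
   level `k − 1` with its source block in `□_k^{(k)}`, or `ρ`-far).
HONEST SCOPE: lattice-geometric bookkeeping; which family the HEAD uses at a boundary datum (n07-e's `Domains.meet` ∕ `domainsOfSeq`, INTENT-44∕44b∕44c), its (2.1)–(2.2) admissibility,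
the transfer `ker Q_{D′} ⊆ ker Q_{D_rec}` (S4's `h128`) and the data on the near cells (BRIDGE-92) are NOT here; nothing of [15]∕[6]∕[B6-II] asserted; `stub_prop8StepCoP13` ∕ K0⁷ NOT
closed; N07 NOT discharged (5∕27 unmoved); one finite 𝕋⁴ programme at fixed ε — R4 closes the conditional finite-𝕋⁴ rung `BalabanLadder.UV` ONLY; the YM mass gap (Clay) is NOT proved by
any of this; nothing continuum ∕ ℝ⁴ ∕ OS.  No `def`, no `instance`, no `notation`, no `sorry`.

References: T. Bałaban, CMP **102** (1985) 277–309 [Balaban1985Variational] (144) p.300, (147)–(150) p.301, (160)–(161) p.303; CMP **99** (1985) 75–102 [Balaban1985RegularSpaces]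
(1.131) p.99; CMP **96** (1984) 223–250 [Balaban1984PropagatorsII] (2.1)–(2.3) p.224.
-/

set_option autoImplicit false

noncomputable section

namespace Summit.QuantumFields.YangMills.Theorems.K0S5CollarMeetFamily

open Literature.MathematicalPhysics.QuantumFieldTheory.Balaban1983to89
open Literature.MathematicalPhysics.QuantumFieldTheory.Balaban1983to89.Node00 (cubeDomains cubeDomains_k)
open Literature.MathematicalPhysics.QuantumLattice (blockMap)
open B15Eq112TorusCover (cover)
open B14DomainGeom (Pt)
open B5Eq117TorusCarriers (Mk)
open B5Eq118OneStroke (iterBlockOf iterBlockOf_succ)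
open B5Prop12FieldsLattice (distSite distSite_nonneg)
open B6SectADomainsV1 (Domains)
open B6SectAOperatorsV1 (BondIdx)
open B8Eq131Cubes (box gs)
open FlatCubeOpsText (distBI)
open FlatPortChart (mul_distSite_blockOf_le)
open K0S5CollarCubeDomains (succ_le_distSite_of_not_deep pow_le_gs)

variable {P : Params} {a : Pt P.d} {M ρ k : ℕ} {hk : k ≤ P.m + P.K}

/-! ## §1  The core collar for ANY family of height `k`, from «the source block is not in the next cube» alone -/

/-- ★★ **THE CORE COLLAR OF (144) FOR ANY FAMILY `D′` OF HEIGHT `k`, IN THE PHYSICAL DISTANCE**: for `b₋ = π x` with `x ∈ □ = box L a M k` and every index bond `c` of `D′` at a level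
`j(c) < k` whose source block does NOT lie in `□_{j(c)+1}^{(j(c)+1)}` of the cube tower `cubeDomains P a M ρ k hk`: `ρ ≤ distBI D′ b c` — P13's `le_distBI_cubeDomains_of_mem_box` with
its one use of the family («`c₋` is not deep in the cube tower») turned into the hypothesis `hnd`; at `D′ := cubeDomains …` it is `c.2.2.1`, at print's (150) family (the meet with
the record) it is the FAR side of the near class. [cite: Balaban1985Variational, (144) p.300, (147)–(150) p.301, (161) p.303; Balaban1985RegularSpaces, (1.131) p.99; Balaban1984PropagatorsII, (2.3) p.224] -/
theorem le_distBI_of_not_cubeDeep {D' : Domains P} (hD'k : D'.k = k) {x : Pt P.d} (hx : x ∈ box P.L a M k) {b : PBond P 0} (hb : b.src = cover P x)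
    (c : BondIdx D') (hc : (c.1.1 : ℕ) < k) (hnd : blockOf c.1.2.src ∉ (cubeDomains P a M ρ k hk).Om ((c.1.1 : ℕ) + 1)) :
    (ρ : ℝ) ≤ distBI D' b c := by
  set j : ℕ := (c.1.1 : ℕ) with hj
  obtain ⟨i, hi⟩ : ∃ i : ℕ, k = j + 1 + i := ⟨k - j - 1, by omega⟩
  have hjk : j + 1 ≤ k := by omega
  have hj1 : j + 1 ≤ P.m + P.K := hjk.trans hk
  have hL1 : (1 : ℝ) ≤ P.L := by exact_mod_cast P.L_pos
  have hL0 : (0 : ℝ) ≤ P.L := by linarith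
  -- (1) the source block is not in the next cube; P13 §2 at level `j + 1`
  have h2 := succ_le_distSite_of_not_deep (hk := hk) hjk hnd hx
  rw [← hb] at h2
  -- (2) one level down
  have hdown := mul_distSite_blockOf_le hj1 (iterBlockOf j b.src) c.1.2.src
  have hsucc : blockOf (iterBlockOf j b.src) = iterBlockOf (j + 1) b.src := rfl
  rw [hsucc] at hdown
  have hki : k - (j + 1) = i := by omega
  rw [hki] at h2
  -- `dist_j ≥ L·(ρ·gs i + 1) − (L − 1) = L·ρ·gs i + 1`
  have hlevj : (P.L : ℝ) * ((ρ : ℝ) * gs P.L i) + 1 ≤ distSite (Mk P j) (iterBlockOf j b.src) c.1.2.src := by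
    have := mul_le_mul_of_nonneg_left h2 hL0
    linarith
  -- (3) `gs i ≥ Lⁱ`, so `L·ρ·gs i ≥ ρ·L^{i+1}`
  have hgs : (P.L : ℝ) ^ i ≤ (gs P.L i : ℝ) := by exact_mod_cast pow_le_gs P.L i
  have hρ0 : (0 : ℝ) ≤ ρ := Nat.cast_nonneg _
  have hmain : (ρ : ℝ) * (P.L : ℝ) ^ (i + 1) ≤ distSite (Mk P j) (iterBlockOf j b.src) c.1.2.src := by
    have h1 : (ρ : ℝ) * (P.L : ℝ) ^ (i + 1) ≤ (P.L : ℝ) * ((ρ : ℝ) * gs P.L i) := by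
      rw [pow_succ]
      have := mul_le_mul_of_nonneg_left hgs hρ0
      nlinarith
    linarith
  -- (4) the scaling of `distBI` (`D′.k = k`)
  have hkj : D'.k - (c.1.1 : ℕ) = i + 1 := by omega
  unfold distBI
  rw [hkj, inv_pow, le_inv_mul_iff₀ (by positivity : (0 : ℝ) < (P.L : ℝ) ^ (i + 1))]
  linarith

/-- ★★ **THE WINDOW FORM, IN THE NEAR-CLASS SOCKET's BINDER SHAPE** (FILE 3 `K0S5NearClassSocket.hbRows164_core_of_adm22_T4_nearClassW`, hypothesis `∀ c, ¬ near c → R′ ≤ distBI D′ b c`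
with `R′ := ρ`): for ANY family `D′` of height `k`, with the near predicate `near c :↔ j(c) = k ∨ B(c₋) ∈ □_{j(c)+1}^{(j(c)+1)}` («the cell is at the top, or its source block lies
in the next cube of the tower» — print's `□″_k` and `□′_k` together with every top-level cell), every NON-near cell is `ρ`-far from every bond based in `π(□)`.
[cite: Balaban1985Variational, (144) p.300, (147)–(150) p.301, (160)–(161) p.303] -/
theorem hcollar_of_not_near {D' : Domains P} (hD'k : D'.k = k) :
    ∀ b : PBond P 0, b.src ∈ cover P '' box P.L a M k →
      ∀ c : BondIdx D', ¬ ((c.1.1 : ℕ) = k ∨ blockOf c.1.2.src ∈ (cubeDomains P a M ρ k hk).Om ((c.1.1 : ℕ) + 1)) →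
        (ρ : ℝ) ≤ distBI D' b c := by
  intro b hb c hc
  obtain ⟨x, hx, hbx⟩ := hb
  obtain ⟨hne, hnd⟩ := not_or.mp hc
  have hle : (c.1.1 : ℕ) ≤ k := by have := c.1.1.isLt; omega
  exact le_distBI_of_not_cubeDeep hD'k hx hbx.symm c (lt_of_le_of_ne hle hne) hnd

/-! ## §2  When `D′` contains the cube tower strictly below the top: the near cells below the top are print's `□′_k^{(k−1)}` -/

/-- ★ **A NEAR CELL BELOW THE TOP IS AT LEVEL `k − 1`**: if `D′` (height `k`) contains the cube tower at the levels `1 ≤ i < k` (the meet `cubeDomains ⊓ D_rec` does, given the HEAD's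
collar `□̃ ⊆ Ω_{k−1}`), then an index bond `c` of `D′` with `j(c) < k` whose source block lies in `□_{j(c)+1}^{(j(c)+1)}` has `j(c) + 1 = k` — at a lower level the block would be
`D′`-deep, contradicting `c ∈ Λ′_{j(c)}` ([B6] (2.3)).  So the near class of §1 is «level `k`» ∪ «level `k − 1` with source block in `□_k^{(k)}`» = print's `□″_k^{(k)} ∪ □′_k^{(k−1)}`
plus the top cells meeting `∂(□_k ∩ Ω_k)`. [cite: Balaban1985Variational, (147)–(150) p.301; Balaban1984PropagatorsII, (2.3) p.224] -/
theorem level_succ_eq_of_near_below {D' : Domains P}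
    (hbelow : ∀ i, 1 ≤ i → i < k → (cubeDomains P a M ρ k hk).Om i ⊆ D'.Om i)
    (c : BondIdx D') (hc : (c.1.1 : ℕ) < k) (hin : blockOf c.1.2.src ∈ (cubeDomains P a M ρ k hk).Om ((c.1.1 : ℕ) + 1)) :
    (c.1.1 : ℕ) + 1 = k := by
  by_contra hne
  have hlt : (c.1.1 : ℕ) + 1 < k := lt_of_le_of_ne (Nat.succ_le_of_lt hc) hne
  have hdeep : D'.Deep (c.1.1 : ℕ) c.1.2.src := hbelow _ (Nat.succ_pos _) hlt hin
  exact c.2.2.1 hdeep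

/-- ★ **THE THREE CASES OF A CELL** (any `D′` of height `k` containing the cube tower at the levels `1 ≤ i < k`): an index bond of `D′` is at the TOP level, or at level `k − 1` with its
source block in the next cube — which is then the top cube `□_k^{(k)}` (print's `□′_k^{(k−1)}` side of the near class) —, or it is NOT near in the sense of §1 (hence `ρ`-far by
`hcollar_of_not_near`).
[cite: Balaban1985Variational, (147)–(150) p.301, (160)–(161) p.303] -/
theorem near_cases {D' : Domains P} (hD'k : D'.k = k)
    (hbelow : ∀ i, 1 ≤ i → i < k → (cubeDomains P a M ρ k hk).Om i ⊆ D'.Om i) (c : BondIdx D') :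
    (c.1.1 : ℕ) = k ∨
    ((c.1.1 : ℕ) + 1 = k ∧ blockOf c.1.2.src ∈ (cubeDomains P a M ρ k hk).Om ((c.1.1 : ℕ) + 1)) ∨
    ¬ ((c.1.1 : ℕ) = k ∨ blockOf c.1.2.src ∈ (cubeDomains P a M ρ k hk).Om ((c.1.1 : ℕ) + 1)) := by
  have hle : (c.1.1 : ℕ) ≤ k := by have := c.1.1.isLt; omega
  rcases eq_or_lt_of_le hle with htop | hlt
  · exact Or.inl htop
  · by_cases hin : blockOf c.1.2.src ∈ (cubeDomains P a M ρ k hk).Om ((c.1.1 : ℕ) + 1)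
    · exact Or.inr (Or.inl ⟨level_succ_eq_of_near_below hbelow c hlt hin, hin⟩)
    · exact Or.inr (Or.inr (not_or.mpr ⟨hlt.ne, hin⟩))

end Summit.QuantumFields.YangMills.Theorems.K0S5CollarMeetFamily

end
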